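import Literature.Analysis.Calculus.ConePoincareHomotopyLinear
import Literature.Analysis.Calculus.ConePoincareHomotopyFiniteDim
import HarnessLib

/-!
# The cone homotopy operator is continuous (finite-dimensional spaces)

A one-theorem complement to `ConePoincareHomotopyLinear.lean` (`continuousAt_conePrimitive`, with an
explicit local bound) and `ConePoincareHomotopyFiniteDim.lean` (`exists_ball_bound_on_cones`: on a
finite-dimensional space the bound is automatic): **`h ω = conePrimitive x₀ ω` is continuous on an
open set `X` star-shaped with respect to `x₀` on which `ω` is continuous** — the side condition under
which cone operators can be iterated (`ConePeriodConePrimitive.conePeriod_conePrimitive`).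
Theorems only. [cite: Spivak1965, Thm. 4-11]

## References

* M. Spivak, *Calculus on Manifolds* (1965), Thm. 4-11. [Spivak1965]
-/

noncomputable section

open Set MeasureTheory Filter Topology

namespace Literature.Analysis.Calculus

variable {E F : Type*} [NormedAddCommGroup E] [NormedSpace ℝ E] [NormedAddCommGroup F] [NormedSpace ℝ F]
  {n : ℕ}

/-- **`h ω` is continuous on `X`** (open, star-shaped with respect to `x₀`, `ω` continuous on `X`,
`E` finite-dimensional). [cite: Spivak1965, Thm. 4-11] -/
theorem continuousOn_conePrimitive [FiniteDimensional ℝ E] {ω : E → E [⋀^Fin (n + 1)]→L[ℝ] F}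
    {X : Set E} {x₀ : E} (hXo : IsOpen X) (hX : StarConvex ℝ x₀ X) (hc : ContinuousOn ω X) :
    ContinuousOn (conePrimitive x₀ ω) X := by
  haveI : ProperSpace E := FiniteDimensional.proper ℝ E
  intro y hy
  obtain ⟨r, C, hr, hball, hC⟩ := exists_ball_bound_on_cones hXo hX hc hc hy
  exact (continuousAt_conePrimitive hXo hX hc hr hball fun y' hy' t ht => (hC y' hy' t ht).1).continuousWithinAt

/-- Iterating: `h_b (h_a ω)` is again continuous on `X` (for the second application the form
`h_a ω` is continuous by the first). [folklore] -/
theorem continuousOn_conePrimitive_conePrimitive [FiniteDimensional ℝ E] {ω : E → E [⋀^Fin (n + 2)]→L[ℝ] F}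
    {X : Set E} {a b : E} (hXo : IsOpen X) (hXa : StarConvex ℝ a X) (hXb : StarConvex ℝ b X)
    (hc : ContinuousOn ω X) :
    ContinuousOn (conePrimitive b (conePrimitive a ω)) X :=
  continuousOn_conePrimitive hXo hXb (continuousOn_conePrimitive hXo hXa hc)

end Literature.Analysis.Calculus

end
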